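import Summits.QuantumFields.YangMills.Theorems.BalabanUVNodesN11PrivateChartOfCentralWindow
import Summits.QuantumFields.YangMills.Theorems.BalabanUVNodesPortS1ChartDummy

/-!
# NODE O port PT-A — FE-1's chart law (T1), brick (B-γ2) of `Lines/pta_residueW-CHART-LAW-PROOF-PLAN-v1.md` §2: N11's PER-BOND CHART `(T, ϑ, jd)` CAN BE TAKEN BLIND TO THE PRIVATE
# COORDINATES `U(β(c′))` — by construction, no export asked of dag-n11 (the plan's E1 answered in-house) — and then the central bond variables of the fibre integral are DUMMIES:
# `T(ρ)(V) = ∫_{U off β} 𝟙·Π jd · ρ(Ψ(V, U)) d(⊗_{b ∉ β} dU(b))` ([I] (2.10) p.267 ∕ p.268 «the integration over … gives a constant» — here the constant is `1`, Haar being a probability)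

Cell `ym-nodeO-ideate`, porter seat PT-A-1 (gen 10); `--kind proof --supports stmt-QuantumFields-27930 --as helper`; count-neutral.  [I] = [Balaban1987RG1]; [III] = [Balaban1988Convergent].
Over dag-n11-w6's ✓`…N11PerBondChartsOfInjectivityWindowsAC` (`exists_perBondCharts_of_injectivityWindows_ac`: the eleven-clause per-bond bundle from injectivity windows ALONE; the sockets
`hpush_privateChart` ∕ `hfib_privateChart` ∕ `transportOfRecord_ae_eq_integral_privateChart_of_support` of ✓`…N11TransportOfRecordInPrivateCoordinateChart`), ✓`…N11PrivateChartOfCentralWindow`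
(the central α-window), pub-ymgap's lit ✓`T4TriangularPushforward` (`IsLocal`, `apply_resample_eq`, `measurable_resample`), ✓`BlockAveragingHaarAC.isLocal_avgFun` (FACT (A): `Ū(c′)` does not
see `U(β(c))`), and PT-A's ✓`…PortS1ChartDummy` ((B-γ1) `setIntegral_pi_of_indep`).

THE POINT (why E1 needs no export).  The bundle's clauses DETERMINE `T_c(U)` (= image of the window under the one-variable map), `ϑ_c(U,·)` on `T_c(U)` (= THE inverse) and `jd_c(U,·)`
(`dv`-a.e., the Radon–Nikodym density) from the window `Ω_c(U)` and the one-variable map `g ↦ Ū(U[β(c) ↦ g])(c)` — both BLIND to every private coordinate (`hΩbl`; FACT (A)).  So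
PRE-COMPOSING the bundle with the resampling `U ↦ extend β 1 U` (all private coordinates overwritten by `1`) gives a bundle that is blind BY CONSTRUCTION and satisfies the SAME eleven
clauses verbatim (§3) — hence the same three sockets — with no a.e. argument at all.

WHAT IS PROVED (0 `def`).
* §1 resampling algebra (generic): `update_extend_eq_extend_update`, `extend_extend_eq_extend`, `measurable_extend_const`.
* §2 ★ `avg_update_centralBond_extend` — the one-variable map of `avOfRecord F N K k` at `c` is blind to every private coordinate (FACT (A) by name).
* §3 ★★★ `exists_blindPerBondCharts_of_injectivityWindows_ac` — from BLIND injectivity windows `(Ω; hΩm, hΩbl, hinj)`: the eleven clauses of dag-n11-w6's bundle AND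
  `T_c(extend β g U) = T_c(U)`, `ϑ_c(extend β g U) = ϑ_c(U)`, `jd_c(extend β g U) = jd_c(U)` for all `g`; ★★ `exists_blindPerBondCharts_centralWindow_ac` (at the record's central α-window,
  `0 ≤ α ≤ 1∕24`, `α < δ_N`, `offCard∕|Idx| + 150α < 1`).
* §4 ★★ `integral_privateChart_eq_integral_offCentral` — for a blind bundle the fibre integrand `U ↦ 𝟙[∀c, V c ∈ T_c U]·Π_c jd_c(U, V c)·ρ(extend β (ϑ_c(U, V c))_c U)` does not read `U` on
  `range β`, so by (B-γ1) `∫ … dU = ∫_{U′ : {b // b ∉ range β} → SU(N)} … (ext₁ U′) d(⊗ dU)` (the dummies give the factor `Π dU(univ) = 1`); ★★★ `transportOfRecord_ae_eq_integral_offCentral_of_support`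
  — N11's transport identity with the central bond variables GONE, for every `dU`-integrable measurable `ρ` with the support clause.

HONEST FRAMING.  Bookkeeping over dag-n11-w6's bundle (pre-composition with a measurable resampling) + Fubini; the Jacobian `jd` stays a Radon–Nikodym VERSION (its identification in
coordinates, (B-d′), and `ϑ = ` PT-A's solved coordinate, (B-e), are NOT here); NO chart of Bałaban's asserted beyond N11's; nothing of (2.10)–(2.14)'s estimates; `FEChartLawStep`∕`FEStepBox`
inhabited nowhere; `stub_P0C`∕`stub_FEstep` OPEN; ⟨27930⟩ OPEN 1∕3; N11∕K1⁷ untouched; NODE O 0∕1; COUNT 8∕28 · K 1∕4 UNMOVED; finite `𝕋⁴_{L^K}` at fixed ε — NOT continuum ∕ OS;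
**the Yang–Mills mass gap (Clay) is NOT proved by any of this.**  No `sorry`, no `def`, no `instance`; standard axioms only.
-/

noncomputable section

open MeasureTheory ProbabilityTheory Set Function
open scoped ENNReal NNReal BigOperators

namespace Summit.QuantumFields.YangMills.Theorems.BalabanUVNodesPortS1

open Literature.MathematicalPhysics.QuantumFieldTheory.Balaban1983to89
open Literature.MathematicalPhysics.QuantumFieldTheory.Balaban1983to89.T4AveragingDisintegration
open Literature.MathematicalPhysics.QuantumFieldTheory.Balaban1983to89.BlockAveraging (Small Idx avgFun loopHol)
open Literature.MathematicalPhysics.QuantumFieldTheory.Balaban1983to89.BlockAveragingHaarAC (centralBond pre post centralBond_injective isLocal_avgFun)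
open Literature.MathematicalPhysics.QuantumFieldTheory.Balaban1983to89.BlockAveragingEMLHaarAC (fibreFamily offCard)
open Literature.MathematicalPhysics.QuantumFieldTheory.Balaban1983to89.ExpMeanLog (expMeanLogSU deltaSU)
open Literature.MathematicalPhysics.QuantumFieldTheory.Balaban1983to89.T4TriangularPushforward (IsLocal apply_resample_eq measurable_resample)
open Summit.QuantumFields.YangMills.Theorems.BalabanUVNodesN11TransportOfRecordInPrivateCoordinateChart
  (succ_le_m_add_K hpush_privateChart hfib_privateChart transportOfRecord_ae_eq_integral_privateChart_of_support measurable_privateChart measurable_privateJacobian)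
open Summit.QuantumFields.YangMills.Theorems.BalabanUVNodesN11PerBondChartsOfInjectivityWindowsAC (exists_perBondCharts_of_injectivityWindows_ac)
open Summit.QuantumFields.YangMills.BalabanUVNodes.N09CentralWindowAtRecord
  (measurableSet_centralWindow centralWindow_extend avgFun_update_centralBond_injOn_centralWindow self_mem_centralWindow_iff)
open Node00 hiding SU
open T4Continuum

/-! ## §1  Resampling algebra -/

section Resample

variable {ι κ G : Type*}

/-- Updating the private coordinate `β c` after resampling all private coordinates = resampling with the updated private datum. [folklore] -/
theorem update_extend_eq_extend_update [DecidableEq ι] [DecidableEq κ] {β : κ → ι} (hβ : Injective β) (U : ι → G) (g : κ → G) (c : κ) (x : G) :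
    update (extend β g U) (β c) x = extend β (update g c x) U := by
  funext i
  by_cases hi : i = β c
  · subst hi
    rw [update_self, hβ.extend_apply, update_self]
  · rw [update_of_ne hi]
    by_cases h : ∃ c', β c' = i
    · obtain ⟨c', rfl⟩ := h
      have hc : c' ≠ c := fun hc => hi (by rw [hc])
      rw [hβ.extend_apply, hβ.extend_apply, update_of_ne hc]
    · rw [extend_apply' _ _ _ h, extend_apply' _ _ _ h]

/-- Resampling twice = resampling once (the last datum wins). [folklore] -/
theorem extend_extend_eq_extend {β : κ → ι} (hβ : Injective β) (U : ι → G) (g g' : κ → G) :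
    extend β g (extend β g' U) = extend β g U := by
  funext i
  by_cases h : ∃ c, β c = i
  · obtain ⟨c, rfl⟩ := h
    rw [hβ.extend_apply, hβ.extend_apply]
  · rw [extend_apply' _ _ _ h, extend_apply' _ _ _ h, extend_apply' _ _ _ h]

/-- Resampling with a FIXED private datum is a measurable self-map of the configurations. [folklore] -/
theorem measurable_extend_const [Fintype ι] [MeasurableSpace G] {β : κ → ι} (hβ : Injective β) (g : κ → G) :
    Measurable fun U : ι → G => extend β g U :=
  (measurable_resample hβ).comp (measurable_id.prodMk measurable_const)

end Resample

/-! ## §2  The one-variable map of the averaging of record is blind to every private coordinate -/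

section OneVariable

variable {F : T4Family} {N : ℕ} [NeZero N] {K k : ℕ}

/-- ★ **FACT (A) FOR THE ONE-VARIABLE MAP**: `Ū(U′[β(c) ↦ x])(c) = Ū(U[β(c) ↦ x])(c)` for `U′ = extend β g U` — the map N11 inverts at `c` does not see any private coordinate
(`isLocal_avgFun` + `apply_resample_eq`, pub-ymgap lit, by name). [cite: Balaban1987RG1, (0.4) p.253; Balaban1985Averaging, (10) p.19] -/
theorem avg_update_centralBond_extend (hk : k < K) (U : GaugeField (F.P K) k (SU N)) (c : PBond (F.P K) (k + 1)) (g : PBond (F.P K) (k + 1) → SU N) (x : SU N) :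
    (avOfRecord F N K k).avg (update (extend centralBond g U) (centralBond c) x) c = (avOfRecord F N K k).avg (update U (centralBond c) x) c := by
  have hkr : k + 1 ≤ (F.P K).m + (F.P K).K := succ_le_m_add_K hk
  rw [update_extend_eq_extend_update (centralBond_injective hkr), avOfRecord_avg,
    apply_resample_eq (isLocal_avgFun hkr expMeanLogSU) (centralBond_injective hkr), update_self]

end OneVariable

/-! ## §3  The blind per-bond bundle -/

section Bundle

variable {F : T4Family} {N : ℕ} [NeZero N] {K k : ℕ}

/-- ★★★ **N11's PER-BOND BUNDLE, BLIND TO THE PRIVATE COORDINATES BY CONSTRUCTION.**  From blind injectivity windows `(Ω; hΩm, hΩbl, hinj)` at step `k < K`: THERE ARE `(T, ϑ, jd)` with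
dag-n11-w6's eleven clauses (joint measurability ×3, `hright`, the inverse change-of-variables law `hlaw`, `T = image`, `hleft`, `ϑ ∈ Ω`) AND `T_c ∕ ϑ_c ∕ jd_c (extend β g U) = T_c ∕ ϑ_c ∕ jd_c (U)`
for every private datum `g` — obtained from ANY bundle by pre-composition with `U ↦ extend β 1 U`, the clauses surviving verbatim because the window and the one-variable map are blind.
[cite: Balaban1987RG1, (0.4) p.253, (2.9)–(2.10) pp.266–267; Balaban1988Convergent, (3.1) p.264; Kechris1995, Thm 15.1] -/
theorem exists_blindPerBondCharts_of_injectivityWindows_ac (hk : k < K)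
    (Ω : PBond (F.P K) (k + 1) → GaugeField (F.P K) k (SU N) → Set (SU N))
    (hΩm : ∀ c, MeasurableSet {p : GaugeField (F.P K) k (SU N) × SU N | p.2 ∈ Ω c p.1})
    (hΩbl : ∀ c (U : GaugeField (F.P K) k (SU N)) (g : PBond (F.P K) (k + 1) → SU N), Ω c (extend centralBond g U) = Ω c U)
    (hinj : ∀ c U, InjOn (fun g => (avOfRecord F N K k).avg (update U (centralBond c) g) c) (Ω c U)) :
    ∃ (T : PBond (F.P K) (k + 1) → GaugeField (F.P K) k (SU N) → Set (SU N))
      (ϑ : PBond (F.P K) (k + 1) → GaugeField (F.P K) k (SU N) → SU N → SU N)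
      (jd : PBond (F.P K) (k + 1) → GaugeField (F.P K) k (SU N) → SU N → ℝ≥0),
      (∀ c, MeasurableSet {p : GaugeField (F.P K) k (SU N) × SU N | p.2 ∈ T c p.1}) ∧
      (∀ c, Measurable fun p : GaugeField (F.P K) k (SU N) × SU N => ϑ c p.1 p.2) ∧
      (∀ c, Measurable fun p : GaugeField (F.P K) k (SU N) × SU N => jd c p.1 p.2) ∧
      (∀ c U, ∀ v ∈ T c U, (avOfRecord F N K k).avg (update U (centralBond c) (ϑ c U v)) c = v) ∧
      (∀ c U, (HaarData.haar : Measure (SU N)).restrict (Ω c U) =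
        (((HaarData.haar : Measure (SU N)).restrict (T c U)).withDensity fun v => (jd c U v : ℝ≥0∞)).map (ϑ c U)) ∧
      (∀ c U, T c U = (fun g => (avOfRecord F N K k).avg (update U (centralBond c) g) c) '' Ω c U) ∧
      (∀ c U, ∀ g ∈ Ω c U, ϑ c U ((avOfRecord F N K k).avg (update U (centralBond c) g) c) = g) ∧
      (∀ c U, ∀ v ∈ T c U, ϑ c U v ∈ Ω c U) ∧
      (∀ c U (g : PBond (F.P K) (k + 1) → SU N), T c (extend centralBond g U) = T c U) ∧
      (∀ c U (g : PBond (F.P K) (k + 1) → SU N), ϑ c (extend centralBond g U) = ϑ c U) ∧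
      (∀ c U (g : PBond (F.P K) (k + 1) → SU N), jd c (extend centralBond g U) = jd c U) := by
  have hkr : k + 1 ≤ (F.P K).m + (F.P K).K := succ_le_m_add_K hk
  have hβ : Injective (centralBond : PBond (F.P K) (k + 1) → PBond (F.P K) k) := centralBond_injective hkr
  obtain ⟨T, ϑ, jd, hTm, hθm, hjm, hright, hlaw, hTim, hleft, hmem⟩ :=
    exists_perBondCharts_of_injectivityWindows_ac (F := F) (N := N) hk Ω hΩm hinj
  -- the resampling with the private datum `1`
  set e : GaugeField (F.P K) k (SU N) → GaugeField (F.P K) k (SU N) := fun U => extend centralBond (1 : PBond (F.P K) (k + 1) → SU N) U with he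
  have hem : Measurable e := measurable_extend_const hβ _
  have hee : ∀ (U : GaugeField (F.P K) k (SU N)) (g : PBond (F.P K) (k + 1) → SU N), e (extend centralBond g U) = e U :=
    fun U g => extend_extend_eq_extend hβ U _ g
  have hmap : ∀ (c : PBond (F.P K) (k + 1)) (U : GaugeField (F.P K) k (SU N)) (x : SU N),
      (avOfRecord F N K k).avg (update (e U) (centralBond c) x) c = (avOfRecord F N K k).avg (update U (centralBond c) x) c :=
    fun c U x => avg_update_centralBond_extend hk U c 1 x
  have hΩe : ∀ c U, Ω c (e U) = Ω c U := fun c U => hΩbl c U 1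
  have hpm : Measurable fun p : GaugeField (F.P K) k (SU N) × SU N => (e p.1, p.2) := (hem.comp measurable_fst).prodMk measurable_snd
  refine ⟨fun c U => T c (e U), fun c U => ϑ c (e U), fun c U => jd c (e U), fun c => ?_, fun c => (hθm c).comp hpm, fun c => (hjm c).comp hpm,
    fun c U v hv => ?_, fun c U => ?_, fun c U => ?_, fun c U g hg => ?_, fun c U v hv => ?_, fun c U g => ?_, fun c U g => ?_, fun c U g => ?_⟩
  · exact (hTm c).preimage hpm
  · rw [← hmap c U]; exact hright c (e U) v hv
  · rw [← hΩe c U, hlaw c (e U)]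
  · show T c (e U) = _
    rw [hTim c (e U), hΩe c U]
    exact image_congr fun x _ => hmap c U x
  · have h := hleft c (e U) g (by rw [hΩe]; exact hg)
    rwa [hmap c U g] at h
  · rw [← hΩe c U]; exact hmem c (e U) v hv
  · show T c (e (extend centralBond g U)) = T c (e U)
    rw [hee]
  · show ϑ c (e (extend centralBond g U)) = ϑ c (e U)
    rw [hee]
  · show jd c (e (extend centralBond g U)) = jd c (e U)
    rw [hee]

/-- ★★ **THE BLIND BUNDLE ON THE RECORD's CENTRAL α-WINDOW** (`0 ≤ α ≤ 1∕24`, `α < δ_N`, `offCard c∕|Idx| + 150α < 1`; dag-n09-w6's window is measurable, blind, and an injectivity window).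
[cite: Balaban1987RG1, (0.4) p.253, (2.9)–(2.10) pp.266–267; Kechris1995, Thm 15.1] -/
theorem exists_blindPerBondCharts_centralWindow_ac (hk : k < K) {α : ℝ} (hα0 : 0 ≤ α) (hα : α ≤ 1 / 24)
    (hαδ : α < deltaSU (Fin N)) (hgap : ∀ c : PBond (F.P K) (k + 1), (offCard c : ℝ) / (Fintype.card (Idx (F.P K)) : ℝ) + 150 * α < 1) :
    ∃ (T : PBond (F.P K) (k + 1) → GaugeField (F.P K) k (SU N) → Set (SU N))
      (ϑ : PBond (F.P K) (k + 1) → GaugeField (F.P K) k (SU N) → SU N → SU N)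
      (jd : PBond (F.P K) (k + 1) → GaugeField (F.P K) k (SU N) → SU N → ℝ≥0),
      (∀ c, MeasurableSet {p : GaugeField (F.P K) k (SU N) × SU N | p.2 ∈ T c p.1}) ∧
      (∀ c, Measurable fun p : GaugeField (F.P K) k (SU N) × SU N => ϑ c p.1 p.2) ∧
      (∀ c, Measurable fun p : GaugeField (F.P K) k (SU N) × SU N => jd c p.1 p.2) ∧
      (∀ c U, ∀ v ∈ T c U, (avOfRecord F N K k).avg (update U (centralBond c) (ϑ c U v)) c = v) ∧
      (∀ c U, (HaarData.haar : Measure (SU N)).restrict {g : SU N | ∀ i : Idx (F.P K), dist1 (fibreFamily U c (pre U c * g * post U c) i) ≤ α} =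
        (((HaarData.haar : Measure (SU N)).restrict (T c U)).withDensity fun v => (jd c U v : ℝ≥0∞)).map (ϑ c U)) ∧
      (∀ c U, T c U = (fun g => (avOfRecord F N K k).avg (update U (centralBond c) g) c) ''
        {g : SU N | ∀ i : Idx (F.P K), dist1 (fibreFamily U c (pre U c * g * post U c) i) ≤ α}) ∧
      (∀ c U, ∀ g ∈ {g : SU N | ∀ i : Idx (F.P K), dist1 (fibreFamily U c (pre U c * g * post U c) i) ≤ α},
        ϑ c U ((avOfRecord F N K k).avg (update U (centralBond c) g) c) = g) ∧
      (∀ c U, ∀ v ∈ T c U, ϑ c U v ∈ {g : SU N | ∀ i : Idx (F.P K), dist1 (fibreFamily U c (pre U c * g * post U c) i) ≤ α}) ∧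
      (∀ c U (g : PBond (F.P K) (k + 1) → SU N), T c (extend centralBond g U) = T c U) ∧
      (∀ c U (g : PBond (F.P K) (k + 1) → SU N), ϑ c (extend centralBond g U) = ϑ c U) ∧
      (∀ c U (g : PBond (F.P K) (k + 1) → SU N), jd c (extend centralBond g U) = jd c U) := by
  have hkr : k + 1 ≤ (F.P K).m + (F.P K).K := succ_le_m_add_K hk
  exact exists_blindPerBondCharts_of_injectivityWindows_ac hk
    (fun c U => {g : SU N | ∀ i : Idx (F.P K), dist1 (fibreFamily U c (pre U c * g * post U c) i) ≤ α})
    (fun c => measurableSet_centralWindow c α) (fun c U g' => centralWindow_extend hkr c α U g')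
    (fun c U => avgFun_update_centralBond_injOn_centralWindow hkr U c hα0 hα hαδ (hgap c))

end Bundle

/-! ## §4  The central bond variables of the fibre integral are dummies -/

section Dummy

variable {F : T4Family} {N : ℕ} [NeZero N] {K k : ℕ}

omit [NeZero N] in
/-- For a blind bundle, N11's fibre integrand at `V` does not read `U` on the central bonds. [cite: Balaban1987RG1, (2.10) p.267, p.268] -/
theorem privateIntegrand_indep (hk : k < K)
    {T : PBond (F.P K) (k + 1) → GaugeField (F.P K) k (SU N) → Set (SU N)}
    {ϑ : PBond (F.P K) (k + 1) → GaugeField (F.P K) k (SU N) → SU N → SU N}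
    {jd : PBond (F.P K) (k + 1) → GaugeField (F.P K) k (SU N) → SU N → ℝ≥0}
    (hTbl : ∀ c U (g : PBond (F.P K) (k + 1) → SU N), T c (extend centralBond g U) = T c U)
    (hθbl : ∀ c U (g : PBond (F.P K) (k + 1) → SU N), ϑ c (extend centralBond g U) = ϑ c U)
    (hjbl : ∀ c U (g : PBond (F.P K) (k + 1) → SU N), jd c (extend centralBond g U) = jd c U)
    (ρ : Density (F.P K) k (SU N)) (V : GaugeField (F.P K) (k + 1) (SU N)) (U U' : GaugeField (F.P K) k (SU N))
    (hUU' : ∀ b, ¬ b ∈ Set.range (centralBond : PBond (F.P K) (k + 1) → PBond (F.P K) k) → U b = U' b) :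
    (({p : GaugeField (F.P K) (k + 1) (SU N) × GaugeField (F.P K) k (SU N) | ∀ c, p.1 c ∈ T c p.2}.indicator
        (fun p => ∏ c, jd c p.2 (p.1 c)) (V, U) : ℝ≥0) : ℝ) * ρ (extend centralBond (fun c => ϑ c U (V c)) U) =
      (({p : GaugeField (F.P K) (k + 1) (SU N) × GaugeField (F.P K) k (SU N) | ∀ c, p.1 c ∈ T c p.2}.indicator
        (fun p => ∏ c, jd c p.2 (p.1 c)) (V, U') : ℝ≥0) : ℝ) * ρ (extend centralBond (fun c => ϑ c U' (V c)) U') := by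
  have hkr : k + 1 ≤ (F.P K).m + (F.P K).K := succ_le_m_add_K hk
  have hβ : Injective (centralBond : PBond (F.P K) (k + 1) → PBond (F.P K) k) := centralBond_injective hkr
  -- `U` is `U'` resampled with `U`'s own private data
  have hU : U = extend centralBond (fun c => U (centralBond c)) U' := by
    funext b
    by_cases h : ∃ c, centralBond c = b
    · obtain ⟨c, rfl⟩ := h
      rw [hβ.extend_apply]
    · rw [extend_apply' _ _ _ h]
      exact hUU' b fun ⟨c, hc⟩ => h ⟨c, hc⟩
  have hT : ∀ c, T c U = T c U' := fun c => by rw [hU, hTbl]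
  have hθ : ∀ c, ϑ c U = ϑ c U' := fun c => by rw [hU, hθbl]
  have hj : ∀ c, jd c U = jd c U' := fun c => by rw [hU, hjbl]
  have hext : extend centralBond (fun c => ϑ c U (V c)) U = extend centralBond (fun c => ϑ c U' (V c)) U' := by
    have hfun : (fun c => ϑ c U (V c)) = fun c => ϑ c U' (V c) := funext fun c => by rw [hθ c]
    rw [hfun]
    conv_lhs => rw [hU]
    rw [extend_extend_eq_extend hβ]
  have hind : {p : GaugeField (F.P K) (k + 1) (SU N) × GaugeField (F.P K) k (SU N) | ∀ c, p.1 c ∈ T c p.2}.indicator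
        (fun p => ∏ c, jd c p.2 (p.1 c)) (V, U) =
      {p : GaugeField (F.P K) (k + 1) (SU N) × GaugeField (F.P K) k (SU N) | ∀ c, p.1 c ∈ T c p.2}.indicator
        (fun p => ∏ c, jd c p.2 (p.1 c)) (V, U') := by
    by_cases h : ∀ c, V c ∈ T c U
    · have h' : ∀ c, V c ∈ T c U' := fun c => by rw [← hT c]; exact h c
      rw [Set.indicator_of_mem (show ((V, U) : GaugeField (F.P K) (k + 1) (SU N) × GaugeField (F.P K) k (SU N)) ∈
            {p : GaugeField (F.P K) (k + 1) (SU N) × GaugeField (F.P K) k (SU N) | ∀ c, p.1 c ∈ T c p.2} from h),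
        Set.indicator_of_mem (show ((V, U') : GaugeField (F.P K) (k + 1) (SU N) × GaugeField (F.P K) k (SU N)) ∈
            {p : GaugeField (F.P K) (k + 1) (SU N) × GaugeField (F.P K) k (SU N) | ∀ c, p.1 c ∈ T c p.2} from h')]
      exact Finset.prod_congr rfl fun c _ => by rw [hj c]
    · have h' : ¬ ∀ c, V c ∈ T c U' := fun h' => h fun c => by rw [hT c]; exact h' c
      rw [Set.indicator_of_notMem (show ((V, U) : GaugeField (F.P K) (k + 1) (SU N) × GaugeField (F.P K) k (SU N)) ∉
            {p : GaugeField (F.P K) (k + 1) (SU N) × GaugeField (F.P K) k (SU N) | ∀ c, p.1 c ∈ T c p.2} from h),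
        Set.indicator_of_notMem (show ((V, U') : GaugeField (F.P K) (k + 1) (SU N) × GaugeField (F.P K) k (SU N)) ∉
            {p : GaugeField (F.P K) (k + 1) (SU N) × GaugeField (F.P K) k (SU N) | ∀ c, p.1 c ∈ T c p.2} from h')]
  rw [hind, hext]

/-- ★★ **THE FIBRE INTEGRAL OVER THE OFF-CENTRAL BOND VARIABLES ONLY**: for a blind bundle, every `ρ`, `V` and dummy configuration `U₀`,
`∫ 𝟙·Π jd·ρ(Ψ(V,U)) dU = ∫_{U′ : {b // b ∉ range β} → SU(N)} (the same at `ext_{U₀} U′) d(⊗_{b∉β} dU(b))` — the central variables integrate to `Π dU(univ) = 1` ((B-γ1) `setIntegral_pi_of_indep`).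
[cite: Balaban1987RG1, (2.10) p.267, p.268; Balaban1985Averaging, (10) p.19] -/
theorem integral_privateChart_eq_integral_offCentral (hk : k < K)
    {T : PBond (F.P K) (k + 1) → GaugeField (F.P K) k (SU N) → Set (SU N)}
    {ϑ : PBond (F.P K) (k + 1) → GaugeField (F.P K) k (SU N) → SU N → SU N}
    {jd : PBond (F.P K) (k + 1) → GaugeField (F.P K) k (SU N) → SU N → ℝ≥0}
    (hTbl : ∀ c U (g : PBond (F.P K) (k + 1) → SU N), T c (extend centralBond g U) = T c U)
    (hθbl : ∀ c U (g : PBond (F.P K) (k + 1) → SU N), ϑ c (extend centralBond g U) = ϑ c U)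
    (hjbl : ∀ c U (g : PBond (F.P K) (k + 1) → SU N), jd c (extend centralBond g U) = jd c U)
    (ρ : Density (F.P K) k (SU N)) (V : GaugeField (F.P K) (k + 1) (SU N)) (U₀ : GaugeField (F.P K) k (SU N)) :
    ∫ U, (({p : GaugeField (F.P K) (k + 1) (SU N) × GaugeField (F.P K) k (SU N) | ∀ c, p.1 c ∈ T c p.2}.indicator
          (fun p => ∏ c, jd c p.2 (p.1 c)) (V, U) : ℝ≥0) : ℝ) *
        ρ (extend centralBond (fun c => ϑ c U (V c)) U) ∂(fieldMeasure (F.P K) k (SU N)) =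
      ∫ U' : {b : PBond (F.P K) k // ¬ b ∈ Set.range (centralBond : PBond (F.P K) (k + 1) → PBond (F.P K) k)} → SU N,
        (fun U : GaugeField (F.P K) k (SU N) =>
          (({p : GaugeField (F.P K) (k + 1) (SU N) × GaugeField (F.P K) k (SU N) | ∀ c, p.1 c ∈ T c p.2}.indicator
            (fun p => ∏ c, jd c p.2 (p.1 c)) (V, U) : ℝ≥0) : ℝ) * ρ (extend centralBond (fun c => ϑ c U (V c)) U))
          (fun b => if h : b ∈ Set.range (centralBond : PBond (F.P K) (k + 1) → PBond (F.P K) k) then U₀ b else U' ⟨b, h⟩)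
        ∂(Measure.pi fun _ => (HaarData.haar : Measure (SU N))) := by
  classical
  have key := setIntegral_pi_of_indep (fun _ : PBond (F.P K) k => (HaarData.haar : Measure (SU N)))
    (fun b => b ∈ Set.range (centralBond : PBond (F.P K) (k + 1) → PBond (F.P K) k)) (fun _ => (Set.univ : Set (SU N)))
    (fun U : GaugeField (F.P K) k (SU N) =>
      (({p : GaugeField (F.P K) (k + 1) (SU N) × GaugeField (F.P K) k (SU N) | ∀ c, p.1 c ∈ T c p.2}.indicator
        (fun p => ∏ c, jd c p.2 (p.1 c)) (V, U) : ℝ≥0) : ℝ) * ρ (extend centralBond (fun c => ϑ c U (V c)) U))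
    U₀ (fun U U' hUU' => privateIntegrand_indep hk hTbl hθbl hjbl ρ V U U' hUU')
  simp only [Set.pi_univ, Measure.restrict_univ, probReal_univ, Finset.prod_const_one, one_smul] at key
  exact key

/-- ★★★ **N11's TRANSPORT IDENTITY WITH THE CENTRAL BOND VARIABLES GONE.**  From blind injectivity windows at step `k < K`: there is a blind bundle `(T, ϑ, jd)` (eleven clauses + blindness, §3)
such that for every `dU`-integrable measurable `ρ` with the support clause and every dummy configuration `U₀`,
`T(ρ)(V) = ∫_{U′ off β} 𝟙[∀c, V c ∈ T_c Ū′]·Π_c jd_c(Ū′, V c)·ρ(extend β (ϑ_c(Ū′, V c))_c Ū′) d(⊗_{b∉β} dU(b))` for `dV`-a.e. `V`, `Ū′ = ext_{U₀} U′` — print's `∫ dV′(b), b ∉ {b₀(c)}` of (2.10).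
[cite: Balaban1987RG1, (2.10) p.267, p.268; Balaban1988Convergent, (3.1) p.264, p.267 L18–24] -/
theorem transportOfRecord_ae_eq_integral_offCentral_of_support (hk : k < K)
    (Ω : PBond (F.P K) (k + 1) → GaugeField (F.P K) k (SU N) → Set (SU N))
    (hΩm : ∀ c, MeasurableSet {p : GaugeField (F.P K) k (SU N) × SU N | p.2 ∈ Ω c p.1})
    (hΩbl : ∀ c (U : GaugeField (F.P K) k (SU N)) (g : PBond (F.P K) (k + 1) → SU N), Ω c (extend centralBond g U) = Ω c U)
    (hinj : ∀ c U, InjOn (fun g => (avOfRecord F N K k).avg (update U (centralBond c) g) c) (Ω c U)) (U₀ : GaugeField (F.P K) k (SU N)) :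
    ∃ (T : PBond (F.P K) (k + 1) → GaugeField (F.P K) k (SU N) → Set (SU N))
      (ϑ : PBond (F.P K) (k + 1) → GaugeField (F.P K) k (SU N) → SU N → SU N)
      (jd : PBond (F.P K) (k + 1) → GaugeField (F.P K) k (SU N) → SU N → ℝ≥0),
      (∀ c, MeasurableSet {p : GaugeField (F.P K) k (SU N) × SU N | p.2 ∈ T c p.1}) ∧
      (∀ c, Measurable fun p : GaugeField (F.P K) k (SU N) × SU N => ϑ c p.1 p.2) ∧
      (∀ c, Measurable fun p : GaugeField (F.P K) k (SU N) × SU N => jd c p.1 p.2) ∧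
      (∀ c U, ∀ v ∈ T c U, (avOfRecord F N K k).avg (update U (centralBond c) (ϑ c U v)) c = v) ∧
      (∀ c U, (HaarData.haar : Measure (SU N)).restrict (Ω c U) =
        (((HaarData.haar : Measure (SU N)).restrict (T c U)).withDensity fun v => (jd c U v : ℝ≥0∞)).map (ϑ c U)) ∧
      (∀ c U, T c U = (fun g => (avOfRecord F N K k).avg (update U (centralBond c) g) c) '' Ω c U) ∧
      (∀ c U, ∀ g ∈ Ω c U, ϑ c U ((avOfRecord F N K k).avg (update U (centralBond c) g) c) = g) ∧
      (∀ c U, ∀ v ∈ T c U, ϑ c U v ∈ Ω c U) ∧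
      (∀ c U (g : PBond (F.P K) (k + 1) → SU N), T c (extend centralBond g U) = T c U) ∧
      (∀ c U (g : PBond (F.P K) (k + 1) → SU N), ϑ c (extend centralBond g U) = ϑ c U) ∧
      (∀ c U (g : PBond (F.P K) (k + 1) → SU N), jd c (extend centralBond g U) = jd c U) ∧
      (∀ {ρ : Density (F.P K) k (SU N)}, Measurable ρ → Integrable ρ (fieldMeasure (F.P K) k (SU N)) →
        (∀ U, ρ U ≠ 0 → ∀ c, U (centralBond c) ∈ Ω c U) →
        transportOfRecord F N K k ρ =ᵐ[fieldMeasure (F.P K) (k + 1) (SU N)] fun V =>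
          ∫ U' : {b : PBond (F.P K) k // ¬ b ∈ Set.range (centralBond : PBond (F.P K) (k + 1) → PBond (F.P K) k)} → SU N,
            (fun U : GaugeField (F.P K) k (SU N) =>
              (({p : GaugeField (F.P K) (k + 1) (SU N) × GaugeField (F.P K) k (SU N) | ∀ c, p.1 c ∈ T c p.2}.indicator
                (fun p => ∏ c, jd c p.2 (p.1 c)) (V, U) : ℝ≥0) : ℝ) * ρ (extend centralBond (fun c => ϑ c U (V c)) U))
              (fun b => if h : b ∈ Set.range (centralBond : PBond (F.P K) (k + 1) → PBond (F.P K) k) then U₀ b else U' ⟨b, h⟩)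
            ∂(Measure.pi fun _ => (HaarData.haar : Measure (SU N)))) := by
  classical
  obtain ⟨T, ϑ, jd, hTm, hθm, hjm, hright, hlaw, hTim, hleft, hmem, hTbl, hθbl, hjbl⟩ :=
    exists_blindPerBondCharts_of_injectivityWindows_ac hk Ω hΩm hΩbl hinj
  refine ⟨T, ϑ, jd, hTm, hθm, hjm, hright, hlaw, hTim, hleft, hmem, hTbl, hθbl, hjbl, fun hρm hρ hS => ?_⟩
  have htr := transportOfRecord_ae_eq_integral_privateChart_of_support Ω T ϑ jd hk hΩm hTm hθm hjm hΩbl hright hlaw hρm hρ hS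
  filter_upwards [htr] with V hV
  rw [hV, integral_privateChart_eq_integral_offCentral hk hTbl hθbl hjbl]

end Dummy

end Summit.QuantumFields.YangMills.Theorems.BalabanUVNodesPortS1

end
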